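import Mathlib
import HarnessLib
import Summits.HubbardSuperconductivity.HubbardSuperconductivity.Theorems.KLProgrammeMatsubaraPairWeightLattice
import Summits.HubbardSuperconductivity.HubbardSuperconductivity.Theorems.KLProgrammeKLRegimeEngineFrameLevelCount

/-!
# Route `KLProgramme` — crux K3 split, ENGINE child (`KLRegimeEngineV11` stmt-HubbardSuperconductivity-19823; Δ21): the norm-inside pair-weight masses
# ON THE CARRIER'S TORUS — the momentum set is `TorusSite 2 L`, the first line's energy is the frame band `e_K = nambuXiCT L μ K`, and the shell count is
# DISCHARGED by k3c2-p1's `card_filter_nambuXiCT_lt_le_of_frameOK` (cell gate-hubbard-kl, seat hubbard-kl-k3c2-p2; p1 g7's «lattice instance second»)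

Instance of `…MatsubaraPairWeightLattice` (generic finite momentum type) with `P := TorusSite 2 L`, `e₁ := nambuXiCT L μ K`, shell
`S := {k⃗ : |e_K(k⃗)| < 4Λ_n}` whose cardinal is `≤ 2200·4Λ_n·L² + 200000·L` for every admissible frame (`FrameOK R U N μ K`), `L ≥ 2^15`, `1 ≤ n`
(`4Λ_n ≤ 1/32`).  Results (`1 ≤ n ≤ n_β + 1`, `β ≥ klBetaMin`, any Matsubara cutoff `M`; first line = slice-`n` propagator in singularity-free form):
* `klzf_card_shell_le` — the shell count at `η = 4Λ_n`;
* `klzf_sum_norm_pair_le` — (2a) sign-blind mass: `Σ_{k⃗} ‖β⁻¹•Σ_i Φ(ω_i, e_K k⃗)·Ψ i k⃗‖ ≤ (8800Λ_n L² + 200000 L)·(32/π)·M_f·A'`;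
* `klzf_sum_norm_pair_shift_le` — (2b) Q-Lipschitz mass: with the second slice propagator read at energies `e₂ k⃗`, `e₂⁰ k⃗` (`= e_K(Q−k⃗)`, `e_K(−k⃗)`),
  `|e₂ − e₂⁰| ≤ D`: `≤ (8800Λ_n L² + 200000 L)·(32/π)·M_f·(192ℓ' + 772M_f')·D/Λ_n²`.
Dividing by the `L²` of the momentum average: (2a) `= O(Λ_n) + O(1/L)`·const and (2b) `≲ D/Λ_n + D/(Λ_n² L)`·const — n-uniform in the volume regime
`L ≳ 1/Λ_n²` … the finite-`L` tail is the engine's `Q.CL β n / L` budget.  Pure bookkeeping over the two cited files.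
-/

noncomputable section

namespace Summit.HubbardSuperconductivity.HubbardSuperconductivity.Theorems.KLRegimeSplit

set_option linter.dupNamespace false -- summit = problem name (single-conjunct summit), D-0017

open Real Finset Complex Literature.MathematicalPhysics.QuantumLattice Literature.Probability.LatticeModels
open Summit.HubbardSuperconductivity.HubbardSuperconductivity.Theorems.KLProgrammeLegKernels
open Summit.HubbardSuperconductivity.HubbardSuperconductivity.Theorems.EngineV8

section Frame

variable {R : RenConsts} {U μ : ℝ} {N : ℕ} {K : TrigPolyC4v} (L : ℕ) [NeZero L]

/-- At scale `n ≥ 1` the shell radius `4Λ_n` is at most `1/32` (`Λ_n = 4^{−n}/32`). -/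
theorem klzf_four_mul_klScale_le {n : ℕ} (hn : 1 ≤ n) : 4 * klScale klE0 n ≤ 1 / 32 := by
  unfold klScale klE0
  have h4 : (4 : ℝ) ≤ (4 : ℝ) ^ n := by
    calc (4 : ℝ) = 4 ^ 1 := by norm_num
      _ ≤ 4 ^ n := pow_le_pow_right₀ (by norm_num) hn
  have hpos : (0 : ℝ) < 4 ^ n := by positivity
  rw [show (4 : ℝ) * (1 / 32 * ((4 : ℝ) ^ n)⁻¹) = (1 / 8) / 4 ^ n by field_simp; ring]
  rw [div_le_iff₀ hpos]
  nlinarith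

/-- **The shell count on the carrier**: for an admissible frame, `L ≥ 2^15`, `1 ≤ n`:
`#{k⃗ : |e_K(k⃗)| < 4Λ_n} ≤ 2200·(4Λ_n)·L² + 200000·L`. -/
theorem klzf_card_shell_le (hK : FrameOK R U N μ K) (hL : (2 : ℝ) ^ 15 ≤ L) {n : ℕ} (hn : 1 ≤ n) :
    (((univ.filter fun k : TorusSite 2 L => |nambuXiCT L μ K k| < 4 * klScale klE0 n).card : ℕ) : ℝ) ≤
      2200 * (4 * klScale klE0 n) * (L : ℝ) ^ 2 + 200000 * L :=
  card_filter_nambuXiCT_lt_le_of_frameOK hK L hL (by have := klth_klScale_pos n; positivity) (klzf_four_mul_klScale_le hn)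

variable {f f' : ℝ → ℂ} {Mf Lf' Mf' ℓ' : ℝ}

/-- **(2a) on the carrier**: the sign-blind norm-inside mass of the slice-`n` line against any bounded partner family,
`Σ_{k⃗} ‖β⁻¹ • Σ_i Φ(ω_i, e_K k⃗)·Ψ i k⃗‖ ≤ (2200·4Λ_n·L² + 200000·L)·((32/π)·M_f·A')`. -/
theorem klzf_sum_norm_pair_le (hK : FrameOK R U N μ K) (hL : (2 : ℝ) ^ 15 ≤ L)
    (hbd : ∀ s, ‖f s‖ ≤ Mf) {n : ℕ} (hn1 : 1 ≤ n)
    (hin : ∀ s, s ≤ (klScale klE0 n / 2) ^ 2 → f s = 0) (hout : ∀ s, (4 * klScale klE0 n) ^ 2 ≤ s → f s = 0)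
    {M : ℕ} {Ψ : MatsubaraIdx M → TorusSite 2 L → ℂ} {A' : ℝ} (hA' : 0 ≤ A') (hΨ : ∀ i p, ‖Ψ i p‖ ≤ A')
    {β : ℝ} (hβ : klBetaMin ≤ β) (hn : n ≤ nScales β + 1) :
    ∑ p : TorusSite 2 L, ‖β⁻¹ • ∑ i : MatsubaraIdx M,
        (f (matsubaraFreq β M i ^ 2 + nambuXiCT L μ K p ^ 2) / (((matsubaraFreq β M i ^ 2 + nambuXiCT L μ K p ^ 2 : ℝ)) : ℂ) *
          (I * (matsubaraFreq β M i) + (nambuXiCT L μ K p : ℝ))) * Ψ i p‖ ≤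
      (2200 * (4 * klScale klE0 n) * (L : ℝ) ^ 2 + 200000 * L) * (32 / Real.pi * Mf * A') := by
  have hMf : 0 ≤ Mf := (norm_nonneg _).trans (hbd 0)
  have h := klzl_sum_norm_pair_scale_le (P := TorusSite 2 L) hbd hin hout (fun p => nambuXiCT L μ K p)
    (univ.filter fun k : TorusSite 2 L => |nambuXiCT L μ K k| < 4 * klScale klE0 n)
    (fun p hp => mem_filter.mpr ⟨mem_univ _, hp⟩) hA' hΨ hβ hn
  exact h.trans (mul_le_mul_of_nonneg_right (klzf_card_shell_le L hK hL hn1) (by positivity))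

/-- **(2b) on the carrier**: the Q-Lipschitz norm-inside mass — second slice propagator read at `e₂ k⃗` and `e₂⁰ k⃗` (`= e_K(Q−k⃗)`, `e_K(−k⃗)`)
with `|e₂ − e₂⁰| ≤ D` (`≤ v_K|Q|_𝕋`), frequency `−ω_i`:
`Σ_{k⃗} ‖β⁻¹ • Σ_i Φ(ω_i, e_K k⃗)·(Ψ(−ω_i, e₂ k⃗) − Ψ(−ω_i, e₂⁰ k⃗))‖ ≤ (2200·4Λ_n·L² + 200000·L)·((32/π)·M_f·(192ℓ' + 772M_f')·D/Λ_n²)`. -/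
theorem klzf_sum_norm_pair_shift_le (hK : FrameOK R U N μ K) (hL : (2 : ℝ) ^ 15 ≤ L)
    (hbd : ∀ s, ‖f s‖ ≤ Mf) {n : ℕ} (hn1 : 1 ≤ n)
    (hin : ∀ s, s ≤ (klScale klE0 n / 2) ^ 2 → f s = 0) (hout : ∀ s, (4 * klScale klE0 n) ^ 2 ≤ s → f s = 0)
    (hlip' : ∀ s s', ‖f' s - f' s'‖ ≤ Lf' * |s - s'|) (hbd' : ∀ s, ‖f' s‖ ≤ Mf') (hLf' : Lf' ≤ ℓ' / klScale klE0 n ^ 2)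
    (hin' : ∀ s, s ≤ (klScale klE0 n / 2) ^ 2 → f' s = 0) (hout' : ∀ s, (4 * klScale klE0 n) ^ 2 ≤ s → f' s = 0)
    (e₂ e₂₀ : TorusSite 2 L → ℝ) {D : ℝ} (hD0 : 0 ≤ D) (hD : ∀ p, |e₂ p - e₂₀ p| ≤ D)
    {M : ℕ} {β : ℝ} (hβ : klBetaMin ≤ β) (hn : n ≤ nScales β + 1) :
    ∑ p : TorusSite 2 L, ‖β⁻¹ • ∑ i : MatsubaraIdx M,
        (f (matsubaraFreq β M i ^ 2 + nambuXiCT L μ K p ^ 2) / (((matsubaraFreq β M i ^ 2 + nambuXiCT L μ K p ^ 2 : ℝ)) : ℂ) *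
          (I * (matsubaraFreq β M i) + (nambuXiCT L μ K p : ℝ))) *
        ((f' ((-matsubaraFreq β M i) ^ 2 + e₂ p ^ 2) / ((((-matsubaraFreq β M i) ^ 2 + e₂ p ^ 2 : ℝ)) : ℂ) *
            (I * ((-matsubaraFreq β M i : ℝ) : ℂ) + (e₂ p : ℝ))) -
          (f' ((-matsubaraFreq β M i) ^ 2 + e₂₀ p ^ 2) / ((((-matsubaraFreq β M i) ^ 2 + e₂₀ p ^ 2 : ℝ)) : ℂ) *
            (I * ((-matsubaraFreq β M i : ℝ) : ℂ) + (e₂₀ p : ℝ))))‖ ≤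
      (2200 * (4 * klScale klE0 n) * (L : ℝ) ^ 2 + 200000 * L) *
        (32 / Real.pi * Mf * (192 * ℓ' + 772 * Mf') * D / klScale klE0 n ^ 2) := by
  have hMf : 0 ≤ Mf := (norm_nonneg _).trans (hbd 0)
  have hMf' : 0 ≤ Mf' := (norm_nonneg _).trans (hbd' 0)
  have hΛ := klth_klScale_pos n
  have hLf'0 : 0 ≤ Lf' := by
    have := hlip' 0 1; have h0 : (0:ℝ) ≤ ‖f' 0 - f' 1‖ := norm_nonneg _; norm_num at this; linarith
  have hℓ' : 0 ≤ ℓ' := by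
    have : 0 ≤ ℓ' / klScale klE0 n ^ 2 := hLf'0.trans hLf'
    rwa [le_div_iff₀ (by positivity), zero_mul] at this
  have h := klzl_sum_norm_pair_shift_scale_le (P := TorusSite 2 L) hbd hin hout hlip' hbd' hLf' hin' hout'
    (fun p => nambuXiCT L μ K p) e₂ e₂₀
    (univ.filter fun k : TorusSite 2 L => |nambuXiCT L μ K k| < 4 * klScale klE0 n)
    (fun p hp => mem_filter.mpr ⟨mem_univ _, hp⟩) hD0 hD (M := M) hβ hn
  exact h.trans (mul_le_mul_of_nonneg_right (klzf_card_shell_le L hK hL hn1) (by positivity))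

end Frame

end Summit.HubbardSuperconductivity.HubbardSuperconductivity.Theorems.KLRegimeSplit

end
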